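import Literature.Algebra.Homology.HomologyMapBijectiveOfCochainCriteria
import Literature.Algebra.Homology.VanishingBaseChangeOfQuasiIso
import HarnessLib

/-!
# Power-torsion of cohomology classes transfers along a map injective on cohomology — in particular along a flat base change
# of a quasi-isomorphism of bounded above complexes of flat modules ([Weibel1994] §1.1; [MumfordAV1970] §5 Lemma 2)

Layer `Literature/Algebra/Homology`, namespace `Literature.Algebra.Homology`.  THEOREMS ONLY (no definition, no named fact, no instance, no
notation, no `sorry`), over ★ `HomologyMapBijectiveOfCochainCriteria` (elements of cycles ∕ classes in `ModuleCat`) and ★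
`VanishingBaseChangeOfQuasiIso` ∕ `FlatQuasiIsoBaseChange` (the `(B ⊗ −)K•` dictionary, Mumford §5 Lemma 2).  Cell `hodgecm-mathlib` (D-0151),
junction (J4) of the «H1-DIM-ANY-CHAR cut» (B-p04 memo v2 §2): the SUPPORT statement ★ B4 `exists_pow_smul_eq_baseChange_d_of_forall_kPoint_basicOpen`
is proved on the base-changed ČECH complex `R′ ⊗ Č•`, while ★ B1∕B2 (`AcyclicityLemmaRegularSequence`, `FreeComplexDualAcyclic`) consume it
on the base-changed GROTHENDIECK complex `R′ ⊗ K•`; the two are related by the quasi-isomorphism `ψ : K• → Č•` of ★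
`exists_strictlyPerfect_quasiIso_cechComplex_of_isProper`.  In the ELEMENTWISE currency of B1∕B4 («every `j`-cocycle `z` has `a^n z` a
coboundary for some `n`»):

* §1 **`exists_d_eq_of_homologyMap_injective`** (`ℤ`-indexed cochain complexes of modules) — if `H^j(F)` is injective, a `j`-cocycle of `K` whose
  image is a coboundary of `L` is a coboundary of `K` (the converse repacking of ★ `homologyMap_injective_of_cochains`).
* §2 **`exists_pow_smul_eq_d_of_homologyMap_injective`** — if `H^j(F)` is injective and every `j`-cocycle of `L` is `r`-power torsion modulo
  coboundaries (`r ∈ R`), so is every `j`-cocycle of `K`.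
* §3 **`exists_pow_smul_eq_baseChange_d_of_quasiIso`** — for a quasi-isomorphism `ψ : P• → C•` of bounded above complexes of FLAT `R`-modules, an
  `R`-algebra `A` and `a ∈ A`: if every `j`-cocycle `z` of `A ⊗_R C•` (differentials `d ⊗ A = LinearMap.baseChange A`) has `aⁿ • z` a coboundary,
  then so does every `j`-cocycle of `A ⊗_R P•` — `(A ⊗ −)ψ` is a quasi-isomorphism (★ `quasiIso_tensorLeft_map_of_flat`, [MumfordAV1970] §5
  Lemma 2), hence injective on `H^j`, and §1 applies to the `A`-multiples.  Indices `i + 1 = j`, `j + 1 = l` free, as in ★ B1∕B4.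

HC_CM is proved only modulo the 7 printed citations until rung 0 closes; nothing here bears on a summit statement (count-neutral capital).

## References
* [Weibel1994] C. A. Weibel, *An introduction to homological algebra* (1994), §1.1 (Def. 1.1.1, Ex. 1.1.2) (cycles, boundaries, `Hⁿ` of a map).
* [MumfordAV1970] D. Mumford, *Abelian Varieties* (1970), §5 Lemma 2 (p. 49).
* [GortzWedhorn2023] U. Görtz, T. Wedhorn, *Algebraic Geometry II* (2023), Rem. 21.92 (2) and Lemma 21.93 (pp. 273–274).
* [StacksProject] The Stacks Project, Tag 0111 (functoriality of cohomology of complexes).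
-/

set_option autoImplicit false

universe u

open CategoryTheory CategoryTheory.Limits CategoryTheory.MonoidalCategory HomologicalComplex TensorProduct

noncomputable section

namespace Literature.Algebra.Homology

/-! ## §1 Injectivity on cohomology, elementwise -/

section Elementwise

variable {R : Type u} [CommRing R] {K L : CochainComplex (ModuleCat.{u} R) ℤ} (F : K ⟶ L)

/-- **Injectivity of `Hⁿ(F)`, elementwise**: if `Hⁿ(F)` is injective, an `n`-cocycle `g` of `K` whose image `F g = d h` is a coboundary of `L`
is a coboundary `d g₀` of `K`. [cite: Weibel1994, §1.1 (Def. 1.1.1, Ex. 1.1.2)] [cite: StacksProject, Tag 0111] -/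
theorem exists_d_eq_of_homologyMap_injective (n : ℤ) (hinj : Function.Injective (homologyMap F n).hom)
    (g : K.X n) (hg : (K.d n (n + 1)).hom g = 0) (h : L.X (n - 1)) (hF : (F.f n).hom g = (L.d (n - 1) n).hom h) :
    ∃ g₀ : K.X (n - 1), (K.d (n - 1) n).hom g₀ = g := by
  obtain ⟨z, hz⟩ := exists_cycles_of_d_eq_zero K n g hg
  -- the class of `F z` vanishes: its cycle is the boundary `toCycles h`
  have hFz : (L.homologyπ n).hom ((cyclesMap F n).hom z) = 0 := by
    rw [homologyπ_eq_zero_iff_exists_toCycles]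
    refine ⟨h, OrderedCech.cycles_ext L n ?_⟩
    rw [iCycles_toCycles_apply, iCycles_cyclesMap_apply, hz, hF]
  -- hence the class of `z` vanishes
  have hz0 : (K.homologyπ n).hom z = 0 := by
    apply hinj
    rw [homologyMap_homologyπ_apply, hFz, map_zero]
  obtain ⟨g₀, hg₀⟩ := (homologyπ_eq_zero_iff_exists_toCycles K n z).1 hz0
  exact ⟨g₀, by rw [← iCycles_toCycles_apply, hg₀, hz]⟩

/-- The same with free indices `i + 1 = j`, `j + 1 = l` (the convention of ★ `AcyclicityLemmaRegularSequence`).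
[cite: Weibel1994, §1.1 (Def. 1.1.1, Ex. 1.1.2)] -/
theorem exists_d_eq_of_homologyMap_injective' (i j l : ℤ) (hij : i + 1 = j) (hjl : j + 1 = l)
    (hinj : Function.Injective (homologyMap F j).hom)
    (g : K.X j) (hg : (K.d j l).hom g = 0) (h : L.X i) (hF : (F.f j).hom g = (L.d i j).hom h) :
    ∃ g₀ : K.X i, (K.d i j).hom g₀ = g := by
  subst hjl
  obtain rfl : i = j - 1 := by omega
  exact exists_d_eq_of_homologyMap_injective F j hinj g hg h hF

/-! ## §2 Power-torsion of cocycles transfers along a map injective on cohomology -/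

/-- **If `Hʲ(F)` is injective and every `j`-cocycle of `L` is `r`-power torsion modulo coboundaries, so is every `j`-cocycle of `K`**:
for a cocycle `g` of `K`, `rᵐ • F g = d h` in `L`, so the cocycle `rᵐ • g` maps to a coboundary and §1 applies.
[cite: Weibel1994, §1.1 (Def. 1.1.1, Ex. 1.1.2)] [cite: StacksProject, Tag 0111] -/
theorem exists_pow_smul_eq_d_of_homologyMap_injective (i j l : ℤ) (hij : i + 1 = j) (hjl : j + 1 = l)
    (hinj : Function.Injective (homologyMap F j).hom) (r : R)
    (hL : ∀ g' : L.X j, (L.d j l).hom g' = 0 → ∃ (m : ℕ) (h : L.X i), r ^ m • g' = (L.d i j).hom h)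
    (g : K.X j) (hg : (K.d j l).hom g = 0) :
    ∃ (m : ℕ) (g₀ : K.X i), r ^ m • g = (K.d i j).hom g₀ := by
  -- `F g` is a cocycle of `L`
  have hFg : (L.d j l).hom ((F.f j).hom g) = 0 := by
    have hc := congrArg (fun φ => φ.hom g) (F.comm j l)
    simp only [ModuleCat.hom_comp, LinearMap.comp_apply] at hc
    rw [hc, hg, map_zero]
  obtain ⟨m, h, hmh⟩ := hL _ hFg
  have hg' : (K.d j l).hom (r ^ m • g) = 0 := by rw [map_smul, hg, smul_zero]
  have hF' : (F.f j).hom (r ^ m • g) = (L.d i j).hom h := by rw [map_smul, hmh]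
  obtain ⟨g₀, hg₀⟩ := exists_d_eq_of_homologyMap_injective' F i j l hij hjl hinj (r ^ m • g) hg' h hF'
  exact ⟨m, g₀, hg₀.symm⟩

end Elementwise

/-! ## §3 Along a flat base change of a quasi-isomorphism (Mumford §5 Lemma 2) -/

section BaseChange

variable {R : Type u} [CommRing R] {P C : CochainComplex (ModuleCat.{u} R) ℤ} (ψ : P ⟶ C)
  (A : Type u) [CommRing A] [Algebra R A]

/-- The components of `(A ⊗ −)ψ` are the base changes `ψⁿ ⊗ A` on elements. [cite: MumfordAV1970, §5 Lemma 2 (p. 49)] -/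
theorem tensorLeft_map_f_hom_apply (n : ℤ) (z : A ⊗[R] P.X n) :
    ((((tensorLeft (ModuleCat.of R A)).mapHomologicalComplex (ComplexShape.up ℤ)).map ψ).f n).hom z =
      (ψ.f n).hom.baseChange A z := by
  rw [LinearMap.baseChange_eq_ltensor]
  rfl

/-- **POWER-TORSION OF COCYCLES PASSES FROM `A ⊗_R C•` TO `A ⊗_R P•` ALONG A QUASI-ISOMORPHISM `ψ : P• → C•` of bounded above complexes of
flat modules** (any `R`-algebra `A`, any `a ∈ A`, free indices `i + 1 = j`, `j + 1 = l`): if every `j`-cocycle `z` of `A ⊗ C•` (differentials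
`LinearMap.baseChange A`) has `aⁿ • z` a coboundary for some `n`, then so does every `j`-cocycle of `A ⊗ P•`.  (★ `quasiIso_tensorLeft_map_of_flat`:
`(A ⊗ −)ψ` is a quasi-isomorphism, hence injective on `Hʲ`; §1 applied to `aⁿ • z`.)  This carries ★ B4's support statement from the Čech complex
to the Grothendieck complex for ★ B1∕B2.
[cite: MumfordAV1970, §5 Lemma 2 (p. 49)] [cite: GortzWedhorn2023, Rem. 21.92 (2) and Lemma 21.93 (pp. 273–274)] [cite: Weibel1994, §1.1 (Def. 1.1.1, Ex. 1.1.2)] -/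
theorem exists_pow_smul_eq_baseChange_d_of_quasiIso [QuasiIso ψ] (hP : ∀ n, Module.Flat R (P.X n)) (hC : ∀ n, Module.Flat R (C.X n))
    (N : ℤ) [P.IsStrictlyLE N] [C.IsStrictlyLE N] (a : A) (i j l : ℤ) (hij : i + 1 = j) (hjl : j + 1 = l)
    (hCnil : ∀ z : A ⊗[R] C.X j, (C.d j l).hom.baseChange A z = 0 →
      ∃ (n : ℕ) (w : A ⊗[R] C.X i), a ^ n • z = (C.d i j).hom.baseChange A w)
    (z : A ⊗[R] P.X j) (hz : (P.d j l).hom.baseChange A z = 0) :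
    ∃ (n : ℕ) (w : A ⊗[R] P.X i), a ^ n • z = (P.d i j).hom.baseChange A w := by
  -- the base-changed complexes and map (Mathlib `tensorLeft` model; differentials `d ⊗ A` by ★ `tensorLeft_d_hom_apply`)
  let K' := ((tensorLeft (ModuleCat.of R A)).mapHomologicalComplex (ComplexShape.up ℤ)).obj P
  let L' := ((tensorLeft (ModuleCat.of R A)).mapHomologicalComplex (ComplexShape.up ℤ)).obj C
  let F : K' ⟶ L' := ((tensorLeft (ModuleCat.of R A)).mapHomologicalComplex (ComplexShape.up ℤ)).map ψ
  haveI : QuasiIso F := quasiIso_tensorLeft_map_of_flat ψ hP hC N (ModuleCat.of R A)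
  have hinj : Function.Injective (homologyMap F j).hom := (ModuleCat.mono_iff_injective _).1 inferInstance
  -- `ψ z` is a cocycle of `A ⊗ C•`
  have hFz : (C.d j l).hom.baseChange A ((ψ.f j).hom.baseChange A z) = 0 := by
    have hc := congrArg (fun φ => φ.hom z) (F.comm j l)
    simp only [ModuleCat.hom_comp, LinearMap.comp_apply] at hc
    rw [tensorLeft_map_f_hom_apply, tensorLeft_d_hom_apply, tensorLeft_d_hom_apply, tensorLeft_map_f_hom_apply] at hc
    rw [hc, hz, map_zero]
  obtain ⟨n, w', hw'⟩ := hCnil _ hFz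
  -- `aⁿ • z` is a cocycle of `A ⊗ P•` mapping to the coboundary `d w'`
  have hz' : (K'.d j l).hom (a ^ n • z) = 0 := by
    rw [tensorLeft_d_hom_apply, map_smul, hz, smul_zero]
    rfl
  have hF' : (F.f j).hom (a ^ n • z) = (L'.d i j).hom w' := by
    rw [tensorLeft_map_f_hom_apply, tensorLeft_d_hom_apply, map_smul, hw']
  obtain ⟨w, hw⟩ := exists_d_eq_of_homologyMap_injective' F i j l hij hjl hinj (a ^ n • z) hz' w' hF'
  refine ⟨n, w, ?_⟩
  rw [← hw, tensorLeft_d_hom_apply]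

/-- The same when the torsion is by the image of `r ∈ R` (e.g. `a = algebraMap R A f`, the shape of ★ B4
`exists_pow_smul_eq_baseChange_d_of_forall_kPoint_basicOpen`). [cite: MumfordAV1970, §5 Lemma 2 (p. 49)] -/
theorem exists_pow_algebraMap_smul_eq_baseChange_d_of_quasiIso [QuasiIso ψ] (hP : ∀ n, Module.Flat R (P.X n))
    (hC : ∀ n, Module.Flat R (C.X n)) (N : ℤ) [P.IsStrictlyLE N] [C.IsStrictlyLE N] (r : R) (i j l : ℤ) (hij : i + 1 = j)
    (hjl : j + 1 = l)
    (hCnil : ∀ z : A ⊗[R] C.X j, (C.d j l).hom.baseChange A z = 0 →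
      ∃ (n : ℕ) (w : A ⊗[R] C.X i), algebraMap R A r ^ n • z = (C.d i j).hom.baseChange A w)
    (z : A ⊗[R] P.X j) (hz : (P.d j l).hom.baseChange A z = 0) :
    ∃ (n : ℕ) (w : A ⊗[R] P.X i), algebraMap R A r ^ n • z = (P.d i j).hom.baseChange A w :=
  exists_pow_smul_eq_baseChange_d_of_quasiIso ψ A hP hC N (algebraMap R A r) i j l hij hjl hCnil z hz

end BaseChange

end Literature.Algebra.Homology

end
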